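import Summits.QuantumFields.BalabanUV.T4Continuum.Support.NE9Lemma1CurveRemainder
import Summits.QuantumFields.BalabanUV.T4Continuum.Support.NE9RemainderPieceCoupling

/-!
# NE9CurveRemainderCoupling — the COUPLING RESPONSE of the CURVE remainder: the Taylor remainder of an analytic old term along
# two nearby analytic slice curves, and the (1.23)-functional of the remainder DIFFERENCE, bounded at FORM level with the gain
# `ϱ⁻ⁿ` kept (cell `pub-balaban`, T4-DAG §2 node U3 ∕ §6 NE9; NE9 formalisation swarm LEAF PROVER 06, lineage leaf-06, generation 7;
# the GENERIC, `CurData`-free half of the row owner's crew row (w20) «A3-REM twin on `CurData`» named in CLAIMS.log l.9603 —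
# the curve twin of leaf-03's ray engine `NE9RemainderPieceCoupling` (p211959); the `CurData`-level producer and END faces are the
# species half, NOT in this file)

HONEST FRAMING (T4-DAG PAGE 1).  Rung (B)+1 of the FINITE-VOLUME T⁴ programme — existence and uniqueness of the ε → 0 limit of
gauge-invariant observables on a FIXED finite torus; NOT infinite volume, NOT a mass gap, NOT the Clay problem.  NE9
(`T4OutputRate.NE9` ∧ `FadingMemory`) is a cell NEW ESTIMATE, NOT PRINTED, NOT discharged here («NE9 ⇐ the named binders»); spine
0/9; 0/18 skeleton leaves instantiated on Bałaban's objects.  HONEST DEPENDENCY (cell line, verbatim): continuum YM on T⁴ ⇐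
BetaPertH ∧ nine spine estimates (0/9 proved); BetaPertH ⇐ (D1) ∧ (D4) ∧ CAP+tail; G-an2-4 gates asym, D1 and NE2/3/4.
`FlowStep.BetaPertH`, (B), (B^μ) do not occur.  [I] = [Balaban1987RG1] (CMP **109**), [II] = [Balaban1988RG2Cluster] (CMP **116**) are
quoted for TYPES only (ABSOLUTE RULE: nothing printed in the audited series is asserted).

THE POINT.  After the owner's LOCATED CORRECTION O-ne9p1g25-1 (`NE9Lemma1CurveRemainder`, p213669) the displayed species' old term is
expanded along the analytic CURVE `σ ↦ U_j(□₀, exp iσB)|_X` of [I] Lemma 4 (3.53) — a ray only for abelian `G`.  Leaf A3 (the channel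
read at two COUPLING arguments on the same old terms) needs, per piece, the response of the curve remainder when the slice curve
moves: at two couplings the shift amplitude, hence the curve, differs, and print's route is (1.24) read for the s-derivative ([II]
p. 8: *"Another possibility is to use the expression g_k|B| instead of ε₁"*).  THIS FILE (kernel, 0 sorry, 0 def):
* §1 **`norm_curRem_sub_curRem_le`** — `H` analytic on `‖z‖ < R` with `‖H z‖ ≤ M` there; two curves `γ, γ′` analytic on the disc
  `|σ| < ϱ`, `ϱ > 1`, with values in the CLOSED ball of radius `R′ < R` and `‖γ σ − γ′ σ‖ ≤ δ` on the disc ⟹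
  `‖curRem H n γ − curRem H n γ′‖ ≤ 2ⁿ·(2M∕(R − R′)·δ)·ϱ⁻¹ⁿ`: the remainder is additive in the composite slice (leaf-03's
  `taylorRem_sub`), the difference slice `σ ↦ H(γσ) − H(γ′σ)` is analytic on the disc with sup `≤ (2M∕(R − R′))·δ` (leaf-03's
  `norm_sub_le_of_ball`), and the owner's `norm_taylorRem_le` applies at `σ = 1`.  Coupling form `…_of_lipschitz` (δ := c·|u − u′|);
  the RAY case recovered as an `example` (leaf-03's `norm_dirRem_sub_dirRem_le` bound, `ϱ = R′∕a`).
* §2 **`norm_curPieceDiff_le`** — the (1.23)-functional (`B13Sect1Arith.cauchyOp` over the cubes + the t_□-circle; the integrand shape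
  of the owner's `curPiece`) of the curve-remainder DIFFERENCE of two slice-curve FAMILIES `Γ, Γ′` which, at every contour point, are
  analytic on the disc into the closed `R′`-ball and `δ`-close there: `≤ (1∕r)·(2ⁿ·(2M∕(R − R′)·δ)·ϱ⁻¹ⁿ)·exp(−(κ₁ − 1)·#cubes)` —
  `B13Sect1Arith.bound_124` with its remainder hypothesis discharged by §1; the ray case recovered as an `example`
  (= `NE9RemainderPieceCoupling.norm_remPieceDiff_le`'s bound).  The identification of this functional with
  `curPiece … Γ − curPiece … Γ′` is linearity of INTEGRABLE contour integrals (the composite-slice continuity of crew row (w19)) —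
  instantiation-side, NOT asserted here.
DISGUISE TEST: one old term, one pair of slice curves (↔ two values of ONE real parameter), a size bound — not NE9, no history.

References (TYPES only): [Balaban1987RG1] T. Bałaban, *Renormalization group approach to lattice gauge field theories. I*, Commun.
Math. Phys. **109** (1987) 249–301, Lemma 4 (3.53)–(3.54) p. 280, (3.34)∕(3.37) p. 277; [Balaban1988RG2Cluster] T. Bałaban, *… II.
Cluster expansions*, Commun. Math. Phys. **116** (1988) 1–22, (1.21)–(1.24) p. 7, p. 8 l. 23–24 (render
`b2b-balaban-ref1/pages/1988-cmp116-rg-II-cluster/1988-cmp116-rg-II-cluster-p008-x2.png`, re-read as an image by this seat).  Summits-side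
NEW work (LEAN PLACEMENT RULE); imports the owner's part 1 `NE9Lemma1CurveRemainder` and leaf-03's `NE9RemainderPieceCoupling` BY NAME;
modifies nothing; 0 sorry.  Value = the curve species' per-piece coupling-response ENGINE at form level, NOT summit progress.
-/

noncomputable section

namespace Summit.QuantumFields.BalabanUV.T4Continuum.NE9CurveRemainderCoupling

open scoped BigOperators
open Metric Set Complex
open Literature.MathematicalPhysics.QuantumFieldTheory.Balaban1983to89
open Summit.QuantumFields.BalabanUV.T4Continuum.NE9Lemma1RemainderPiece
open Summit.QuantumFields.BalabanUV.T4Continuum.NE9Lemma1CurveRemainder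
open Summit.QuantumFields.BalabanUV.T4Continuum.NE9RemainderPieceCoupling (taylorRem_sub norm_sub_le_of_ball
  norm_dirRem_sub_dirRem_le)

/-! ## §1 The curve remainder is Lipschitz in the curve, with the gain `ϱ⁻ⁿ` kept -/

section Curve

variable {E : Type*} [NormedAddCommGroup E] [NormedSpace ℂ E] {F : Type*} [NormedAddCommGroup F] [NormedSpace ℂ F]
  [CompleteSpace F]

omit [NormedSpace ℂ E] in
/-- A curve with values in the closed ball of radius `R′ < R` maps into the open ball of radius `R`. [folklore] -/
theorem mapsTo_ball_of_norm_le {γ : ℂ → E} {ϱ R R' : ℝ} (hγR : ∀ σ ∈ ball (0 : ℂ) ϱ, ‖γ σ‖ ≤ R') (hR'R : R' < R) :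
    MapsTo γ (ball 0 ϱ) (ball 0 R) := fun σ hσ =>
  mem_ball_zero_iff.mpr ((hγR σ hσ).trans_lt hR'R)

/-- **THE CURVE REMAINDER IS LIPSCHITZ IN THE CURVE WITH THE GAIN KEPT (kernel; the theorem of this file).**  `H` analytic on
`‖z‖ < R` with `‖H z‖ ≤ M` there; two slice curves `γ, γ′` analytic on the disc `|σ| < ϱ` (`ϱ > 1`), with values in the closed ball
of radius `R′ < R` and `‖γ σ − γ′ σ‖ ≤ δ` on the disc.  Then `‖curRem H n γ − curRem H n γ′‖ ≤ 2ⁿ·(2M∕(R − R′)·δ)·ϱ⁻¹ⁿ`: the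
remainder is additive in the composite slice, the difference slice is analytic on the disc with sup `≤ (2M∕(R − R′))·δ` (Lipschitz
bound of a bounded analytic map on the smaller ball), and the Taylor-remainder bound applies to it at `σ = 1`.  In print's letters
(`M ↔ E₀e^{−κd_j(X)}` (1.18), `ϱ⁻¹ ↔ (α₁∕α₃)L^jη` (3.53), `δ ↔` the displacement of the Lemma-4 curve between two shift amplitudes):
the response keeps the full `(L^jη)ⁿ` of the remainder and is linear in the displacement. [cite: Balaban1987RG1, (3.53)-(3.54) p.280] -/
theorem norm_curRem_sub_curRem_le {H : E → F} {R R' M ϱ δ : ℝ} {n : ℕ} (hH : DifferentiableOn ℂ H (ball 0 R))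
    (hM : ∀ z ∈ ball (0 : E) R, ‖H z‖ ≤ M) (hR'R : R' < R) (hϱ : 1 < ϱ) {γ γ' : ℂ → E}
    (hγ : DifferentiableOn ℂ γ (ball 0 ϱ)) (hγ' : DifferentiableOn ℂ γ' (ball 0 ϱ))
    (hγR : ∀ σ ∈ ball (0 : ℂ) ϱ, ‖γ σ‖ ≤ R') (hγ'R : ∀ σ ∈ ball (0 : ℂ) ϱ, ‖γ' σ‖ ≤ R')
    (hδ : ∀ σ ∈ ball (0 : ℂ) ϱ, ‖γ σ - γ' σ‖ ≤ δ) :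
    ‖curRem H n γ - curRem H n γ'‖ ≤ 2 ^ n * (2 * M / (R - R') * δ) * ϱ⁻¹ ^ n := by
  have hϱ0 : 0 < ϱ := one_pos.trans hϱ
  have h0 : (0 : ℂ) ∈ ball (0 : ℂ) ϱ := mem_ball_self hϱ0
  have hR' : 0 ≤ R' := (norm_nonneg _).trans (hγR 0 h0)
  have hR : 0 < R := hR'.trans_lt hR'R
  have hM0 : 0 ≤ M := (norm_nonneg _).trans (hM 0 (mem_ball_self hR))
  have hcoef : 0 ≤ 2 * M / (R - R') := div_nonneg (by positivity) (sub_pos.mpr hR'R).le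
  have hd := differentiableOn_curSlice hH hγ (mapsTo_ball_of_norm_le hγR hR'R)
  have hd' := differentiableOn_curSlice hH hγ' (mapsTo_ball_of_norm_le hγ'R hR'R)
  -- the difference slice and its sup bound on the disc
  have hsup : ∀ σ ∈ ball (0 : ℂ) ϱ,
      ‖((fun σ : ℂ => H (γ σ)) - fun σ : ℂ => H (γ' σ)) σ‖ ≤ 2 * M / (R - R') * δ := by
    intro σ hσ
    rw [Pi.sub_apply]
    calc ‖H (γ σ) - H (γ' σ)‖ ≤ 2 * M / (R - R') * ‖γ σ - γ' σ‖ := norm_sub_le_of_ball hH hM hR'R (hγR σ hσ) (hγ'R σ hσ)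
      _ ≤ 2 * M / (R - R') * δ := mul_le_mul_of_nonneg_left (hδ σ hσ) hcoef
  have h1 : (1 : ℂ) ∈ ball (0 : ℂ) ϱ := by rw [mem_ball_zero_iff, norm_one]; exact hϱ
  have hrem := norm_taylorRem_le (n := n) (hd.sub hd') hsup h1
  unfold curRem
  rw [← taylorRem_sub hϱ0 hd hd' n 1]
  rw [norm_one, one_div] at hrem
  exact hrem

/-- COUPLING FORM: a slice-curve FAMILY `γ u` indexed by a real parameter `u` (↔ the last coupling, entering through the shift
amplitude), Lipschitz in `u` on the disc with constant `c`: the curve remainder responds by at most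
`2ⁿ·(2M∕(R − R′)·(c·|u − u′|))·ϱ⁻¹ⁿ` — the per-piece coupling-response SHAPE (gain × |Δcoupling|) of leaf A3 for the curve species.
[cite: Balaban1988RG2Cluster, (1.24) p.7] -/
theorem norm_curRem_sub_curRem_le_of_lipschitz {H : E → F} {R R' M ϱ c : ℝ} {n : ℕ} (hH : DifferentiableOn ℂ H (ball 0 R))
    (hM : ∀ z ∈ ball (0 : E) R, ‖H z‖ ≤ M) (hR'R : R' < R) (hϱ : 1 < ϱ) {γ : ℝ → ℂ → E}
    (hγ : ∀ u, DifferentiableOn ℂ (γ u) (ball 0 ϱ)) (hγR : ∀ u, ∀ σ ∈ ball (0 : ℂ) ϱ, ‖γ u σ‖ ≤ R')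
    (hlip : ∀ u u', ∀ σ ∈ ball (0 : ℂ) ϱ, ‖γ u σ - γ u' σ‖ ≤ c * |u - u'|) (u u' : ℝ) :
    ‖curRem H n (γ u) - curRem H n (γ u')‖ ≤ 2 ^ n * (2 * M / (R - R') * (c * |u - u'|)) * ϱ⁻¹ ^ n :=
  norm_curRem_sub_curRem_le hH hM hR'R hϱ (hγ u) (hγ u') (hγR u) (hγR u') (hlip u u')

/-- CONSISTENCY WITH THE RAY ENGINE (leaf-03's `NE9RemainderPieceCoupling.norm_dirRem_sub_dirRem_le`): along two rays `σ ↦ σ•A`,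
`σ ↦ σ•A′` with `‖A‖, ‖A′‖ ≤ a`, `0 < a < R′ < R`, the curve bound at `ϱ = R′∕a`, `δ = (R′∕a)·‖A − A′‖` is exactly
`2ⁿ·(2M∕(R − R′)·(R′∕a)·‖A − A′‖)·(a∕R′)ⁿ`. [folklore] -/
example {H : E → F} {R R' M a : ℝ} {n : ℕ} (hH : DifferentiableOn ℂ H (ball 0 R))
    (hM : ∀ z ∈ ball (0 : E) R, ‖H z‖ ≤ M) (ha : 0 < a) (haR' : a < R') (hR'R : R' < R) {A A' : E}
    (hA : ‖A‖ ≤ a) (hA' : ‖A'‖ ≤ a) :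
    ‖dirRem H n A - dirRem H n A'‖ ≤ 2 ^ n * (2 * M / (R - R') * (R' / a) * ‖A - A'‖) * (a / R') ^ n := by
  have hϱ : 1 < R' / a := by rwa [lt_div_iff₀ ha, one_mul]
  have hray : ∀ {B : E}, ‖B‖ ≤ a → ∀ σ ∈ ball (0 : ℂ) (R' / a), ‖σ • B‖ ≤ R' := by
    intro B hB σ hσ
    rw [mem_ball_zero_iff] at hσ
    rw [norm_smul]
    calc ‖σ‖ * ‖B‖ ≤ R' / a * a := mul_le_mul hσ.le hB (norm_nonneg _) (div_nonneg (ha.le.trans haR'.le) ha.le)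
      _ = R' := div_mul_cancel₀ R' ha.ne'
  have hδ : ∀ σ ∈ ball (0 : ℂ) (R' / a), ‖σ • A - σ • A'‖ ≤ R' / a * ‖A - A'‖ := by
    intro σ hσ
    rw [mem_ball_zero_iff] at hσ
    rw [← smul_sub, norm_smul]
    exact mul_le_mul_of_nonneg_right hσ.le (norm_nonneg _)
  have h := norm_curRem_sub_curRem_le (n := n) hH hM hR'R hϱ (differentiableOn_ray A _) (differentiableOn_ray A' _)
    (hray hA) (hray hA') hδ
  rw [curRem_ray, curRem_ray, inv_div] at h
  calc ‖dirRem H n A - dirRem H n A'‖ ≤ 2 ^ n * (2 * M / (R - R') * (R' / a * ‖A - A'‖)) * (a / R') ^ n := h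
    _ = 2 ^ n * (2 * M / (R - R') * (R' / a) * ‖A - A'‖) * (a / R') ^ n := by ring

end Curve

/-! ## §2 The (1.23)-functional of the curve-remainder DIFFERENCE: `bound_124` with its hypothesis discharged by §1 -/

section Piece

variable {E : Type*} [NormedAddCommGroup E] [NormedSpace ℂ E] {F : Type*} [NormedAddCommGroup F] [NormedSpace ℂ F]
  [CompleteSpace F] {ι : Type*} [DecidableEq ι]

/-- **THE PER-PIECE COUPLING-RESPONSE BOUND FOR THE CURVE SPECIES AT FORM LEVEL (kernel).**  With `ρ = e^{κ₁}`, `κ₁ ≥ 1`, the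
t_□-radius `r > 0`, an old term `H` analytic on the ball of radius `R` and bounded by `M` there, and two slice-curve FAMILIES
`Γ, Γ′` (↔ the Lemma-4 curve through the contour point at two shift amplitudes) which, at every contour point, are analytic on the
disc `|σ′| < ϱ` (`ϱ > 1`), take values in the closed ball of radius `R′ < R`, and differ by at most `δ` on the disc (↔ `c·|s − s′|`,
TYPE (1.21), displayed): the (1.23)-functional of the curve-remainder DIFFERENCE is bounded by
`(1∕r)·(2ⁿ·(2M∕(R − R′)·δ)·ϱ⁻¹ⁿ)·exp(−(κ₁ − 1)·#cubes)` — `B13Sect1Arith.bound_124` with `hS'` discharged by `norm_curRem_sub_curRem_le`.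
When the contour integrals of the two remainders are integrable this functional IS `curPiece ρ r l H n Γ s σ − curPiece ρ r l H n Γ′ s σ`
(linearity of the integral; instantiation-side, not asserted here). [cite: Balaban1988RG2Cluster, (1.23)-(1.24) p.7] -/
theorem norm_curPieceDiff_le {κ₁ r R R' M ϱ δ : ℝ} {n : ℕ} (hκ : 1 ≤ κ₁) (hr : 0 < r) {H : E → F}
    (hH : DifferentiableOn ℂ H (ball 0 R)) (hM : ∀ z ∈ ball (0 : E) R, ‖H z‖ ≤ M) (hR'R : R' < R) (hϱ : 1 < ϱ)
    (hδ : 0 ≤ δ) (l : List ι) (Γ Γ' : ℂ → (ι → ℝ) → (ι → ℂ) → ℂ → E)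
    (hΓ : ∀ t ∈ Metric.sphere (0 : ℂ) r, ∀ s σ,
      (∀ i ∈ l, s i ∈ Set.Icc (0 : ℝ) 1 ∧ σ i ∈ Metric.sphere (0 : ℂ) (Real.exp κ₁)) →
        DifferentiableOn ℂ (Γ t s σ) (ball 0 ϱ) ∧ ∀ σ' ∈ ball (0 : ℂ) ϱ, ‖Γ t s σ σ'‖ ≤ R')
    (hΓ' : ∀ t ∈ Metric.sphere (0 : ℂ) r, ∀ s σ,
      (∀ i ∈ l, s i ∈ Set.Icc (0 : ℝ) 1 ∧ σ i ∈ Metric.sphere (0 : ℂ) (Real.exp κ₁)) →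
        DifferentiableOn ℂ (Γ' t s σ) (ball 0 ϱ) ∧ ∀ σ' ∈ ball (0 : ℂ) ϱ, ‖Γ' t s σ σ'‖ ≤ R')
    (hΓΓ' : ∀ t ∈ Metric.sphere (0 : ℂ) r, ∀ s σ,
      (∀ i ∈ l, s i ∈ Set.Icc (0 : ℝ) 1 ∧ σ i ∈ Metric.sphere (0 : ℂ) (Real.exp κ₁)) →
        ∀ σ' ∈ ball (0 : ℂ) ϱ, ‖Γ t s σ σ' - Γ' t s σ σ'‖ ≤ δ)
    (s : ι → ℝ) (σ : ι → ℂ) (hsσ : ∀ i ∈ l, s i ∈ Set.Icc (0 : ℝ) 1 ∧ σ i ∈ Metric.sphere (0 : ℂ) (Real.exp κ₁)) :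
    ‖(2 * Real.pi * I : ℂ)⁻¹ • ∮ t in C(0, r), (t ^ 2)⁻¹ •
        B13Sect1Arith.cauchyOp (Real.exp κ₁) l
          (fun s' σ' => curRem H n (Γ t s' σ') - curRem H n (Γ' t s' σ')) s σ‖ ≤
      (1 / r) * (2 ^ n * (2 * M / (R - R') * δ) * ϱ⁻¹ ^ n) * Real.exp (-(κ₁ - 1) * l.length) := by
  -- the bound on the contours, from §1
  have hS' : ∀ t ∈ Metric.sphere (0 : ℂ) r, ∀ s σ,
      (∀ i ∈ l, s i ∈ Set.Icc (0 : ℝ) 1 ∧ σ i ∈ Metric.sphere (0 : ℂ) (Real.exp κ₁)) →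
        ‖curRem H n (Γ t s σ) - curRem H n (Γ' t s σ)‖ ≤ 2 ^ n * (2 * M / (R - R') * δ) * ϱ⁻¹ ^ n :=
    fun t ht s σ hsσ => norm_curRem_sub_curRem_le hH hM hR'R hϱ (hΓ t ht s σ hsσ).1 (hΓ' t ht s σ hsσ).1
      (hΓ t ht s σ hsσ).2 (hΓ' t ht s σ hsσ).2 (hΓΓ' t ht s σ hsσ)
  -- nonnegativity of the bound (M ≥ 0 read off at an admissible contour point: t = r, s ≡ 0, σ ≡ e^{κ₁}, σ′ = 0)
  have hS0 : 0 ≤ 2 ^ n * (2 * M / (R - R') * δ) * ϱ⁻¹ ^ n := by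
    have ht : ((r : ℝ) : ℂ) ∈ Metric.sphere (0 : ℂ) r := by simp [abs_of_pos hr]
    have hpar : ∀ i ∈ l, (fun _ : ι => (0 : ℝ)) i ∈ Set.Icc (0 : ℝ) 1 ∧
        (fun _ : ι => ((Real.exp κ₁ : ℝ) : ℂ)) i ∈ Metric.sphere (0 : ℂ) (Real.exp κ₁) := by
      intro i _
      refine ⟨⟨le_rfl, zero_le_one⟩, ?_⟩
      simp
    have h0 : (0 : ℂ) ∈ ball (0 : ℂ) ϱ := mem_ball_self (one_pos.trans hϱ)
    have hR' : 0 ≤ R' := (norm_nonneg _).trans ((hΓ _ ht _ _ hpar).2 0 h0)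
    have hR : 0 < R := hR'.trans_lt hR'R
    have hM0 : 0 ≤ M := (norm_nonneg _).trans (hM 0 (mem_ball_self hR))
    have := sub_pos.mpr hR'R
    positivity
  exact B13Sect1Arith.bound_124 hκ hr hS0 l (fun t s' σ' => curRem H n (Γ t s' σ') - curRem H n (Γ' t s' σ')) hS' s σ hsσ

/-- CONSISTENCY WITH THE RAY ENGINE (leaf-03's `NE9RemainderPieceCoupling.norm_remPieceDiff_le`): for ray families
`Γ t s σ = (σ′ ↦ σ′ • A t s σ)`, `Γ′` likewise with `A′`, direction norms `≤ a` and gap `≤ δ` on the contours, `0 < a < R′ < R`, the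
curve bound at `ϱ = R′∕a` with displacement `(R′∕a)·δ` is the ray bound `(1∕r)·(2ⁿ·(2M∕(R − R′)·(R′∕a)·δ)·(a∕R′)ⁿ)·exp(−(κ₁ − 1)·#cubes)`
for the same functional (`curRem … (σ′ ↦ σ′ • A) = dirRem … A` definitionally). [folklore] -/
example {κ₁ r R R' M a δ : ℝ} {n : ℕ} (hκ : 1 ≤ κ₁) (hr : 0 < r) {H : E → F}
    (hH : DifferentiableOn ℂ H (ball 0 R)) (hM : ∀ z ∈ ball (0 : E) R, ‖H z‖ ≤ M) (ha : 0 < a) (haR' : a < R')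
    (hR'R : R' < R) (hδ : 0 ≤ δ) (l : List ι) (A A' : ℂ → (ι → ℝ) → (ι → ℂ) → E)
    (hA : ∀ t ∈ Metric.sphere (0 : ℂ) r, ∀ s σ,
      (∀ i ∈ l, s i ∈ Set.Icc (0 : ℝ) 1 ∧ σ i ∈ Metric.sphere (0 : ℂ) (Real.exp κ₁)) → ‖A t s σ‖ ≤ a)
    (hA' : ∀ t ∈ Metric.sphere (0 : ℂ) r, ∀ s σ,
      (∀ i ∈ l, s i ∈ Set.Icc (0 : ℝ) 1 ∧ σ i ∈ Metric.sphere (0 : ℂ) (Real.exp κ₁)) → ‖A' t s σ‖ ≤ a)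
    (hAA' : ∀ t ∈ Metric.sphere (0 : ℂ) r, ∀ s σ,
      (∀ i ∈ l, s i ∈ Set.Icc (0 : ℝ) 1 ∧ σ i ∈ Metric.sphere (0 : ℂ) (Real.exp κ₁)) → ‖A t s σ - A' t s σ‖ ≤ δ)
    (s : ι → ℝ) (σ : ι → ℂ) (hsσ : ∀ i ∈ l, s i ∈ Set.Icc (0 : ℝ) 1 ∧ σ i ∈ Metric.sphere (0 : ℂ) (Real.exp κ₁)) :
    ‖(2 * Real.pi * I : ℂ)⁻¹ • ∮ t in C(0, r), (t ^ 2)⁻¹ •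
        B13Sect1Arith.cauchyOp (Real.exp κ₁) l
          (fun s' σ' => dirRem H n (A t s' σ') - dirRem H n (A' t s' σ')) s σ‖ ≤
      (1 / r) * (2 ^ n * (2 * M / (R - R') * (R' / a) * δ) * (a / R') ^ n) * Real.exp (-(κ₁ - 1) * l.length) := by
  have hϱ : 1 < R' / a := by rwa [lt_div_iff₀ ha, one_mul]
  have hR'a : 0 ≤ R' / a := div_nonneg (ha.le.trans haR'.le) ha.le
  have hray : ∀ {B : E}, ‖B‖ ≤ a → ∀ σ' ∈ ball (0 : ℂ) (R' / a), ‖σ' • B‖ ≤ R' := by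
    intro B hB σ' hσ'
    rw [mem_ball_zero_iff] at hσ'
    rw [norm_smul]
    calc ‖σ'‖ * ‖B‖ ≤ R' / a * a := mul_le_mul hσ'.le hB (norm_nonneg _) hR'a
      _ = R' := div_mul_cancel₀ R' ha.ne'
  have h := norm_curPieceDiff_le (n := n) hκ hr hH hM hR'R hϱ (mul_nonneg hR'a hδ) l
    (fun t s' σ' τ => τ • A t s' σ') (fun t s' σ' τ => τ • A' t s' σ')
    (fun t ht s σ hsσ => ⟨differentiableOn_ray _ _, hray (hA t ht s σ hsσ)⟩)
    (fun t ht s σ hsσ => ⟨differentiableOn_ray _ _, hray (hA' t ht s σ hsσ)⟩)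
    (fun t ht s σ hsσ σ' hσ' => by
      rw [mem_ball_zero_iff] at hσ'
      rw [← smul_sub, norm_smul]
      exact mul_le_mul hσ'.le (hAA' t ht s σ hsσ) (norm_nonneg _) hR'a)
    s σ hsσ
  rw [inv_div] at h
  calc _ ≤ (1 / r) * (2 ^ n * (2 * M / (R - R') * (R' / a * δ)) * (a / R') ^ n) * Real.exp (-(κ₁ - 1) * l.length) := h
    _ = (1 / r) * (2 ^ n * (2 * M / (R - R') * (R' / a) * δ) * (a / R') ^ n) * Real.exp (-(κ₁ - 1) * l.length) := by
        ring

end Piece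

end Summit.QuantumFields.BalabanUV.T4Continuum.NE9CurveRemainderCoupling

end
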